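import Summits.BirchSwinnertonDyer.BirchSwinnertonDyer.Theorems.AdditiveBranchIMCGenusKolyvaginTransportAdapters
import Summits.BirchSwinnertonDyer.BirchSwinnertonDyer.Theorems.ErratumRoadFiveEulerHalfModularHeegnerFamilyTrace
import Summits.BirchSwinnertonDyer.Rank1Residual.X11b.KolyvaginTowerLiftConcrete
import Literature.NumberTheory.EllipticCurves.HeegnerTraceRelationBirchProofs
import Literature.NumberTheory.EllipticCurves.CMPointsCongruenceRelation
import Literature.NumberTheory.EllipticCurves.HeegnerPointsKolyvaginEulerSystem
import Literature.NumberTheory.Automorphic.ShimuraCurveRibetTakahashiPeterssonTwistDescentProofs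
import Literature.NumberTheory.EllipticCurves.RootNumberTwistSemistableProofs
import Literature.NumberTheory.EllipticCurves.RootNumberProofs
import Literature.NumberTheory.EllipticCurves.LeadingTermBSZOrdinaryProofs
import Literature.NumberTheory.EllipticCurves.PAdicGrossZagierConstantTermProofs
import HarnessLib

/-!
# Crux `GordTwoRankZeroOffCaseOne` (+ twin `MultLower`): labels (B4) TRACE and (B5) CONGRUENCE for the genus family
# `y″(m) = Θ_{ϑ_m}(y_{E′}(m))`, one Kolyvagin level at a time

Cell `bsd-addord`, lead seat `cruxlead-19357` (g2); HELPER for the registered stub `stub_genusKolyvaginPointsR[M]`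
(`Cruxes/GordTwoRankZeroOffCaseOne/Lines/three_field_road.lean` v9, `Cruxes/MultLower/Lines/tame_roads_mult.lean` v9;
lead report 4 §2), landed `--supports … --as helper`. THEOREMS ONLY (no definition, no named fact, no `sorry`).

## What

The bare family of the genus line is `y″(m) = Θ_{ϑ_m}(y_{E′}(m)) ∈ Wd(K″[m])`, `Wd = C₂ • (D • E′)^{(d₁)}`, with
`ϑ_m = χ_{d₁}(m)·θ` a square root of `d₁` in `K″[m]` and `y_{E′}(m) ∈ E′(K″[m])` over Gross's `x(m)`. K4e′
(`hpointsRk_of_shimuraLabels_kolyvaginGuarded`) wants labels (B4), (B5) at square-free products of Kolyvagin primes.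
Here they are proved ONE LEVEL AT A TIME from the `E′`-side theorems/facts of the tree:

* §0 bookkeeping at a Kolyvagin prime `ℓ` of `(Wd, K″, p)`, `p ≥ 5`: `ℓ` is odd (`kolyvaginPrime_ne_two`);
  `E′ ≅ Wd^{(d₁)}` is good at `ℓ` (`hasGoodReductionAtPrime_of_twist_presentation`); `a_ℓ(Wd) = (d₁/ℓ)·a_ℓ(E′)`
  (`frobeniusTrace_twist_eq`, Silverman X.2.4 / Ex. 10.16 via the tree's `LFunction_quadraticTwist_intCast_apply_prime_pow_of_not_dvd`).
* §1 **`label_B4_level`**: `Σ_{i ≤ ℓ} σ^i Θ_ϑ(y) = a_ℓ(Wd) · Θ_{ϑ′}(y′)↑` — Gross's Prop. 3.7 (1) for `E′` under BIRCH's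
  condition (THEOREM `HeegnerTraceBirch.sum_pointGalHom_eq_lFunction_smul_of_birch`), `G_ℓ` enumerated by powers of `σ`
  (x11b3 `sum_range_pow_eq_sum_image`), `Θ` past `G_ℓ` (which fixes `ϑ ∈ K″[1]·ℚ`), `Θ_ϑ ∘ ↑ = (d₁/ℓ)·(↑ ∘ Θ_{ϑ′})`.
* §2 **`label_B5_level`**: `red(Θ_ϑ y) = Frob_ℓ · red((Θ_{ϑ′} y′)↑)` on every conjugate, in the rows' `geomReduction`
  currency — Nekovář 2007 Prop. (4.9) for `E′` BY NAME (`Nekovar2007.cmPoint_frobeniusCongruence`, the only non-theorem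
  input), transported by p671608/p673193 `frobCongruentModPlace_twist'` and read through bsd-cm's plumbing
  `geomReduction_pointsEquiv_symm_smul_eq_of_frobCongruent`.

HONEST FRAMING: (B5) is conditional on the named fact `Nekovar2007.cmPoint_frobeniusCongruence` (a hypothesis here);
nothing about Selmer groups or BSD is asserted; no stub is closed by this file alone. BSD is not proved by any of this.
[cite: GrossLMS1991, §3 Prop. 3.7 (1)–(2), Prop. 6.2 (2)] [cite: Nekovar2007, Prop. 4.9, Prop. 4.13 (ii)]
[cite: SilvermanAEC2009, X.2 Prop. 2.4, X.5 Cor. 5.4, VII.2 Prop. 2.1, App. C §16]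
presearch: (B4) for CM points under Birch → tree theorem (HeegnerTraceRelationBirchProofs); (B5) → tree named fact
(Nekovář 4.9, CMPointsCongruenceRelation, bsd-cm 2026-08-28); `lean search 'label_B4|genus.*B5'` → nothing prior.
-/

noncomputable section

open scoped Classical

set_option linter.dupNamespace false
set_option autoImplicit false

namespace Summit.BirchSwinnertonDyer.BirchSwinnertonDyer.Theorems.GenusKolyvagin

open WeierstrassCurve NumberField Field Literature.NumberTheory.EllipticCurves
  Literature.NumberTheory.EllipticCurves.ModularForms
  Summit.BirchSwinnertonDyer.Rank1Residual.X11b.RingClassTower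

variable {K : Type} [Field K] [NumberField K]

/-! ## §0 Kolyvagin primes for `p ≥ 5`; the fourth curve at a Kolyvagin prime -/

/-- A Kolyvagin prime for `(W, K, p)` with `p ≥ 5` is odd (`p ∣ ℓ + 1`). [cite: GrossLMS1991, §3 (3.3)] -/
theorem kolyvaginPrime_ne_two (W : WeierstrassCurve ℚ) [W.IsElliptic] {N p ℓ : ℕ} (hp5 : 5 ≤ p)
    (hp : p.Prime) (hℓ : IsKolyvaginPrime N W K p ℓ) : ℓ ≠ 2 := by
  rintro rfl
  have hF : FrobEqFrobInfty W K (p ^ 1) 2 := by rw [pow_one]; exact hℓ.2.2.2.2.2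
  obtain ⟨hdvd, -⟩ := IsKolyvaginPrime.pow_dvd_add_one W hp hℓ (M := 1) le_rfl hF
  have h3 : (p : ℤ) ∣ 3 := by simpa using hdvd
  have hp3 : p ∣ 3 := by exact_mod_cast h3
  have := Nat.le_of_dvd (by norm_num) hp3
  omega

/-- **`E′ ≅ Wd^{(d)}` is good at every odd prime `ℓ ∤ d` where `Wd` is good** (a twist by an `ℓ`-unit keeps the
reduction type; good reduction is model-independent). [cite: SilvermanAEC2009, VII.5 Prop. 5.1, X.5 Cor. 5.4] -/
theorem hasGoodReductionAtPrime_of_twist_presentation (Wd E' : WeierstrassCurve ℚ) [Wd.IsElliptic]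
    [E'.IsElliptic] {d : ℤ} (hE' : ∃ C : VariableChange ℚ, C • Wd.quadraticTwist (d : ℚ) = E') {ℓ : ℕ}
    [Fact ℓ.Prime] (hℓ2 : ℓ ≠ 2) (hℓd : ¬ (ℓ : ℤ) ∣ d) (hgood : Wd.HasGoodReductionAtPrime ℓ) :
    E'.HasGoodReductionAtPrime ℓ := by
  have hℓ : ℓ.Prime := Fact.out
  obtain ⟨C, hC⟩ := hE'
  have hd0 : (d : ℚ) ≠ 0 := by exact_mod_cast (show d ≠ 0 by rintro rfl; exact hℓd (dvd_zero _))
  haveI := Wd.isElliptic_quadraticTwist hd0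
  rw [← hC, BSZLemma17.hasGoodReductionAtPrime_smul_iff]
  set v : IsDedekindDomain.HeightOneSpectrum ℤ :=
    (Rat.HeightOneSpectrum.primesEquiv (R := ℤ)).symm ⟨ℓ, hℓ⟩ with hv
  have hgen : Rat.HeightOneSpectrum.natGenerator v = ℓ :=
    congrArg (fun q : Nat.Primes ↦ (q : ℕ))
      ((Rat.HeightOneSpectrum.primesEquiv (R := ℤ)).apply_symm_apply ⟨ℓ, hℓ⟩)
  have h1 := (Wd.hasGoodReductionAtPrime_iff_hasGoodReductionAt_holds ⟨ℓ, hℓ⟩).mp hgood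
  have h2 := (Wd.hasReductionAt_quadraticTwist_iff_of_not_dvd v (by rw [hgen]; exact hℓ2)
    (d := d) (by rw [hgen]; exact hℓd)).1.mpr h1
  exact ((Wd.quadraticTwist (d : ℚ)).hasGoodReductionAtPrime_iff_hasGoodReductionAt_holds ⟨ℓ, hℓ⟩).mpr h2

/-- **`a_ℓ(Wd) = (d/ℓ)·a_ℓ(E′)` for `Wd = C₂ • (D • E′)^{(d)}` at an odd prime `ℓ ∤ d` of good reduction for both.**
[cite: SilvermanAEC2009, X.2 Prop. 2.4, Exercise 10.16, App. C §16] -/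
theorem frobeniusTrace_twist_eq (E' : WeierstrassCurve ℚ) [E'.IsElliptic] [E'.IsGloballyMinimal]
    (D C₂ : VariableChange ℚ) (d : ℤ) [(C₂ • (D • E').quadraticTwist (d : ℚ)).IsElliptic]
    [(C₂ • (D • E').quadraticTwist (d : ℚ)).IsGloballyMinimal] {ℓ : ℕ} [Fact ℓ.Prime] (hℓ2 : ℓ ≠ 2)
    (hℓd : ¬ (ℓ : ℤ) ∣ d) (hgoodW : (C₂ • (D • E').quadraticTwist (d : ℚ)).HasGoodReductionAtPrime ℓ)
    (hgoodE : E'.HasGoodReductionAtPrime ℓ) :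
    (C₂ • (D • E').quadraticTwist (d : ℚ)).frobeniusTrace ℓ = legendreSym ℓ d * E'.frobeniusTrace ℓ := by
  have hℓ : ℓ.Prime := Fact.out
  have hd0 : (d : ℚ) ≠ 0 := by exact_mod_cast (show d ≠ 0 by rintro rfl; exact hℓd (dvd_zero _))
  haveI := E'.isElliptic_quadraticTwist hd0
  haveI : (D • E').IsElliptic := inferInstance
  haveI := (D • E').isElliptic_quadraticTwist hd0
  rw [← LFunction_apply_prime_eq_frobeniusTrace _ ℓ hgoodW, ← LFunction_apply_prime_eq_frobeniusTrace _ ℓ hgoodE,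
    LFunction_smul, quadraticTwist_smul, LFunction_smul]
  obtain ⟨v, hv⟩ : ∃ v : IsDedekindDomain.HeightOneSpectrum (𝓞 ℚ),
      (Rat.HeightOneSpectrum.primesEquiv v : ℕ) = ℓ :=
    ⟨Rat.HeightOneSpectrum.primesEquiv.symm ⟨ℓ, hℓ⟩, by rw [Equiv.apply_symm_apply]⟩
  have key := E'.LFunction_quadraticTwist_intCast_apply_prime_pow_of_not_dvd d v (by rw [hv]; exact hℓ2)
    (by rw [hv]; exact hℓd) 1
  rw [hv, pow_one, pow_one] at key
  rw [key, jacobiSym.legendreSym.to_jacobiSym]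

/-! ## §1 Label (B4): the trace relation for the transported points -/

/-- **(B4) for the genus family at one Kolyvagin level.** `Σ_{i ≤ ℓ} σ^i Θ_ϑ(y) = a_ℓ(Wd) · Θ_{ϑ′}(y′)↑` in `Wd(K″[m])`
for a square-free `m` prime to `N_{E′}`, an odd prime `ℓ ∣ m` inert in `K″` with `ℓ ∤ d₁`, good for `Wd` and `E′`, a
generator `σ` of `G_ℓ`, roots `ϑ ∈ K″[m]`, `ϑ′ ∈ K″[m/ℓ]` of `d₁` with `ϑ = (d₁/ℓ)ϑ′` in `ℂ`, and points `y`, `y′` of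
`E′` over `x(m)`, `x(m/ℓ)` (`d_{K″} < −4`, Birch orientation `β`). [cite: GrossLMS1991, Prop. 3.7 (1)]
[cite: SilvermanAEC2009, X.2 Prop. 2.4, X.5 Cor. 5.4] -/
theorem label_B4_level (hK : IsImaginaryQuadratic K) (ι : K →+* ℂ) (hD4 : NumberField.discr K < -4)
    (E' : WeierstrassCurve ℚ) [E'.IsElliptic] [E'.IsGloballyMinimal] [NeZero (E'.conductorNorm ℤ)]
    (D C₂ : VariableChange ℚ) [(D • E').IsCharNeTwoNF] (d₁ : ℤ)
    [(C₂ • (D • E').quadraticTwist (d₁ : ℚ)).IsElliptic]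
    [(C₂ • (D • E').quadraticTwist (d₁ : ℚ)).IsGloballyMinimal]
    (Dt : ModularParametrizationData E' (E'.conductorNorm ℤ)) {β : ℤ}
    (hβ : (4 * (E'.conductorNorm ℤ : ℕ) : ℤ) ∣ β ^ 2 - NumberField.discr K)
    {m ℓ : ℕ} [Fact ℓ.Prime] (hm : Squarefree m) (hℓm : ℓ ∈ m.primeFactors) (hℓ2 : ℓ ≠ 2)
    (hinert : (Ideal.span {(ℓ : 𝓞 K)}).IsPrime) (hℓd : ¬ (ℓ : ℤ) ∣ d₁)
    (hgoodW : (C₂ • (D • E').quadraticTwist (d₁ : ℚ)).HasGoodReductionAtPrime ℓ)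
    (hgoodE : E'.HasGoodReductionAtPrime ℓ) (hmN : Nat.Coprime m (E'.conductorNorm ℤ))
    (hle : ringClassField K ι (m / ℓ) ≤ ringClassField K ι m)
    (σ : ringClassField K ι m ≃ₐ[ℚ] ringClassField K ι m)
    (hσ : Subgroup.zpowers σ = ringClassGalOver ι m (m / ℓ))
    {ϑ : ringClassField K ι m} (hϑ2 : ϑ ^ 2 = algebraMap ℚ (ringClassField K ι m) (d₁ : ℚ)) (hϑ0 : ϑ ≠ 0)
    {ϑ' : ringClassField K ι (m / ℓ)}
    (hϑ'2 : ϑ' ^ 2 = algebraMap ℚ (ringClassField K ι (m / ℓ)) (d₁ : ℚ)) (hϑ'0 : ϑ' ≠ 0)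
    (hϑϑ' : (ϑ : ℂ) = (legendreSym ℓ d₁ : ℂ) * (ϑ' : ℂ))
    {y : (E'.baseChange (ringClassField K ι m)).toAffine.Point}
    (hy : Affine.Point.map (ringClassField K ι m).subtype.toRatAlgHom y =
      heegnerPointComplexOfConductor Dt (NumberField.discr K) β m)
    {y' : (E'.baseChange (ringClassField K ι (m / ℓ))).toAffine.Point}
    (hy' : Affine.Point.map (ringClassField K ι (m / ℓ)).subtype.toRatAlgHom y' =
      heegnerPointComplexOfConductor Dt (NumberField.discr K) β (m / ℓ)) :
    letI : Algebra K ℂ := ι.toAlgebra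
    ∑ i ∈ Finset.range (ℓ + 1), pointGalHom (C₂ • (D • E').quadraticTwist (d₁ : ℚ)) (ringClassField K ι m)
        (σ ^ i) (VariableChange.pointEquivBaseChange ((D • E').quadraticTwist (d₁ : ℚ)) C₂ (ringClassField K ι m)
          ((VariableChange.pointEquiv (((D • E').quadraticTwist (d₁ : ℚ)).baseChange (ringClassField K ι m)) (untwistAt hϑ0)).symm
            ((Affine.Point.congrEquiv (untwistAt_smul_eq (D • E') hϑ2 hϑ0)).symm
              (VariableChange.pointEquivBaseChange E' D (ringClassField K ι m) y)))) =
      (C₂ • (D • E').quadraticTwist (d₁ : ℚ)).frobeniusTrace ℓ •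
        Affine.Point.map ((RingClassField.inclusion ι hle).restrictScalars ℚ)
          (VariableChange.pointEquivBaseChange ((D • E').quadraticTwist (d₁ : ℚ)) C₂ (ringClassField K ι (m / ℓ))
          ((VariableChange.pointEquiv (((D • E').quadraticTwist (d₁ : ℚ)).baseChange (ringClassField K ι (m / ℓ))) (untwistAt hϑ'0)).symm
            ((Affine.Point.congrEquiv (untwistAt_smul_eq (D • E') hϑ'2 hϑ'0)).symm
              (VariableChange.pointEquivBaseChange E' D (ringClassField K ι (m / ℓ)) y')))) := by
  letI : Algebra K ℂ := ι.toAlgebra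
  have hℓ : ℓ.Prime := Fact.out
  have hm0 : m ≠ 0 := hm.ne_zero
  have hℓdvd : ℓ ∣ m := Nat.dvd_of_mem_primeFactors hℓm
  have hn : ℓ * (m / ℓ) = m := Nat.mul_div_cancel' hℓdvd
  have hm'0 : m / ℓ ≠ 0 := fun h ↦ hm0 (by rw [← hn, h, mul_zero])
  have hℓm' : ¬ ℓ ∣ m / ℓ := by
    intro h
    have hsq : ℓ * ℓ ∣ m := hn ▸ mul_dvd_mul_left ℓ h
    exact hℓ.one_lt.ne' (Nat.isUnit_iff.mp (hm ℓ hsq))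
  have hm'dvd : m / ℓ ∣ m := Nat.div_dvd_of_dvd hℓdvd
  have hNm' : Nat.Coprime (m / ℓ) (E'.conductorNorm ℤ) := Nat.Coprime.coprime_dvd_left hm'dvd hmN
  have hℓN : ¬ ℓ ∣ E'.conductorNorm ℤ := fun h ↦
    hℓ.one_lt.ne' ((Nat.Coprime.coprime_dvd_left hℓdvd hmN).eq_one_of_dvd h)
  have hunits : 2 ≤ m / ℓ ∨ NumberField.discr K < -4 := Or.inr hD4
  have hw : legendreSym ℓ d₁ = 1 ∨ legendreSym ℓ d₁ = -1 :=
    legendreSym.eq_one_or_neg_one ℓ (by rwa [Ne, ZMod.intCast_zmod_eq_zero_iff_dvd])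
  -- the powers of `σ` fix `ϑ` (its complex value lies in `K″[m/ℓ]`)
  have hϑmem : (ϑ : ℂ) ∈ ringClassField K ι (m / ℓ) := by
    rw [hϑϑ']
    exact Subfield.mul_mem _ (by exact_mod_cast Subfield.intCast_mem _ (legendreSym ℓ d₁)) ϑ'.2
  have hfix : ∀ i : ℕ, (σ ^ i) ϑ = ((1 : ℤ) : ringClassField K ι m) * ϑ := by
    intro i
    have hmem : σ ^ i ∈ ringClassGalOver ι m (m / ℓ) := hσ ▸ Subgroup.pow_mem _ (Subgroup.mem_zpowers σ) i
    rw [Int.cast_one, one_mul]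
    exact (mem_fixingSubgroup_iff _).mp hmem ϑ hϑmem
  -- `Θ` past the sum
  have h1 : ∑ i ∈ Finset.range (ℓ + 1),
      pointGalHom (C₂ • (D • E').quadraticTwist (d₁ : ℚ)) (ringClassField K ι m) (σ ^ i)
        (VariableChange.pointEquivBaseChange ((D • E').quadraticTwist (d₁ : ℚ)) C₂ (ringClassField K ι m)
          ((VariableChange.pointEquiv (((D • E').quadraticTwist (d₁ : ℚ)).baseChange (ringClassField K ι m)) (untwistAt hϑ0)).symm
            ((Affine.Point.congrEquiv (untwistAt_smul_eq (D • E') hϑ2 hϑ0)).symm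
              (VariableChange.pointEquivBaseChange E' D (ringClassField K ι m) y)))) =
      (VariableChange.pointEquivBaseChange ((D • E').quadraticTwist (d₁ : ℚ)) C₂ (ringClassField K ι m)
          ((VariableChange.pointEquiv (((D • E').quadraticTwist (d₁ : ℚ)).baseChange (ringClassField K ι m)) (untwistAt hϑ0)).symm
            ((Affine.Point.congrEquiv (untwistAt_smul_eq (D • E') hϑ2 hϑ0)).symm
              (VariableChange.pointEquivBaseChange E' D (ringClassField K ι m) (∑ i ∈ Finset.range (ℓ + 1), pointGalHom E' (ringClassField K ι m) (σ ^ i) y))))) := by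
    rw [map_sum, map_sum, map_sum, map_sum]
    refine Finset.sum_congr rfl fun i _ => ?_
    rw [pointGalHom_twist' E' D C₂ (d₁ : ℚ) hϑ2 hϑ0 (σ ^ i) (Or.inl rfl) (hfix i) y, one_smul]
  -- Gross 3.7 (1) for `E′` under Birch, in range-sum shape
  have hG := fun g => mem_image_pow_iff_mem_ringClassGalOver hK ι hn hℓ hinert hℓm' hm'0 hunits hσ g
  have hy₀ : Affine.Point.map (ringClassField K ι m).subtype.toRatAlgHom
      (Affine.Point.map ((RingClassField.inclusion ι hle).restrictScalars ℚ) y') =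
      heegnerPointComplexOfConductor Dt (NumberField.discr K) β (m / ℓ) := by
    rw [← hy']
    exact map_toRatAlgHom_map_inclusion (W := E') ι hle (ringClassField K ι m).subtype
      (ringClassField K ι (m / ℓ)).subtype (fun x' => RingClassField.coe_inclusion ι hle x') y'
  have h2 : ∑ i ∈ Finset.range (ℓ + 1), pointGalHom E' (ringClassField K ι m) (σ ^ i) y =
      E'.frobeniusTrace ℓ • Affine.Point.map ((RingClassField.inclusion ι hle).restrictScalars ℚ) y' := by
    rw [sum_range_pow_eq_sum_image hK ι hn hℓ hinert hℓm' hm'0 hunits hσ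
      (fun g => pointGalHom E' (ringClassField K ι m) g y),
      HeegnerTraceBirch.sum_pointGalHom_eq_lFunction_smul_of_birch hK ι Dt hβ hℓ hinert hℓN hℓm' hm'0
      hNm' hunits hn hG hy hy₀, LFunction_apply_prime_eq_frobeniusTrace E' ℓ hgoodE]
  -- `↑ϑ′ = (d₁/ℓ) ϑ` inside `K″[m]`
  have hincl : ((RingClassField.inclusion ι hle).restrictScalars ℚ) ϑ' =
      ((legendreSym ℓ d₁ : ℤ) : ringClassField K ι m) * ϑ := by
    apply Subtype.ext
    show ((RingClassField.inclusion ι hle ϑ' : ringClassField K ι m) : ℂ) = _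
    rw [RingClassField.coe_inclusion, Subfield.coe_mul, hϑϑ', ← mul_assoc]
    push_cast
    rcases hw with h | h <;> simp [h]
  have h3 := map_twist_of_eq_intCast_mul' E' D C₂ (d₁ : ℚ) hϑ'2 hϑ'0 hϑ2 hϑ0
    ((RingClassField.inclusion ι hle).restrictScalars ℚ) hw hincl y'
  -- assemble
  rw [h1, h2, map_zsmul, map_zsmul, map_zsmul, map_zsmul,
    frobeniusTrace_twist_eq E' D C₂ d₁ hℓ2 hℓd hgoodW hgoodE, mul_comm, ← smul_smul]
  congr 1
  -- from `h3 : (Θ_{ϑ′} y′)↑ = w • Θ_ϑ (y′↑)`: `Θ_ϑ (y′↑) = w • (Θ_{ϑ′} y′)↑` as `w² = 1`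
  have hw2 : (legendreSym ℓ d₁) * (legendreSym ℓ d₁) = 1 := by rcases hw with h | h <;> simp [h]
  rw [h3, smul_smul, hw2, one_smul]

/-! ## §2 Label (B5): the congruence for the transported points, in the rows' reduction currency -/

/-- **(B5) for the genus family at one Kolyvagin level** (conditional on Nekovář 2007 Prop. 4.9 for `E′` BY NAME): with the
data of `label_B4_level` (`m` square-free prime to `N_{E′}`; `ℓ ∣ m` an odd prime inert in `K″`, `ℓ ∤ d₁`, good for
`Wd` and `E′`; roots `ϑ = (d₁/ℓ)·ϑ′`; `y`, `y′` over `x(m)`, `x(m/ℓ)`), for the reduction map `geomReduction hΔ` of `Wd` at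
the place over `ℓ`, the `ℓ`-Frobenius `φ₀`, a coordinatewise embedding `j = (·)map emb` of `Wd(K″[m])` into `Wd(K̄″)`
and every `γ ∈ Aut(K″[m])`: `red(θ⁻¹(j(γ·Θ_ϑ y))) = φ₀ • red(θ⁻¹(j(γ·(Θ_{ϑ′} y′)↑)))` — the `hB5` clause of K4e′.
Proof: Nekovář 4.9 gives `y ≡ Frob_ℓ(y′↑)` on `E′` at every place over `ℓ`; p671608 transports it along `Θ` with the
Euler sign; `Θ_{ϑ″}(y′↑) = (Θ_{ϑ′} y′)↑` for `ϑ″ = ϑ′↑`; bsd-cm's plumbing reads it in the `geomReduction` currency.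
[cite: Nekovar2007, Prop. 4.9, Prop. 4.13 (ii)] [cite: GrossLMS1991, Prop. 3.7 (2), Prop. 6.2 (2)]
[cite: SilvermanAEC2009, VII.2 Prop. 2.1, X.5 Cor. 5.4] -/
theorem label_B5_level (hNek : Nekovar2007.cmPoint_frobeniusCongruence)
    (hK : IsImaginaryQuadratic K) (ι : K →+* ℂ)
    (E' : WeierstrassCurve ℚ) [E'.IsElliptic] [E'.IsGloballyMinimal] [NeZero (E'.conductorNorm ℤ)]
    (D C₂ : VariableChange ℚ) [(D • E').IsCharNeTwoNF] (d₁ : ℤ)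
    [(C₂ • (D • E').quadraticTwist (d₁ : ℚ)).IsElliptic]
    [(C₂ • (D • E').quadraticTwist (d₁ : ℚ)).IsGloballyMinimal]
    (Dt : ModularParametrizationData E' (E'.conductorNorm ℤ)) {β : ℤ}
    (hβ : (4 * (E'.conductorNorm ℤ : ℕ) : ℤ) ∣ β ^ 2 - NumberField.discr K)
    {m ℓ : ℕ} [Fact ℓ.Prime] (hm : Squarefree m) (hℓm : ℓ ∈ m.primeFactors) (hℓ2 : ℓ ≠ 2)
    (hinert : (Ideal.span {(ℓ : 𝓞 K)}).IsPrime) (hℓd : ¬ (ℓ : ℤ) ∣ d₁)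
    (hgoodE : E'.HasGoodReductionAtPrime ℓ) (hmN : Nat.Coprime m (E'.conductorNorm ℤ))
    (hΔ : ¬ (ℓ : ℤ) ∣ minimalDiscriminantInt (C₂ • (D • E').quadraticTwist (d₁ : ℚ)))
    (hle : ringClassField K ι (m / ℓ) ≤ ringClassField K ι m)
    {ϑ : ringClassField K ι m} (hϑ2 : ϑ ^ 2 = algebraMap ℚ (ringClassField K ι m) (d₁ : ℚ)) (hϑ0 : ϑ ≠ 0)
    {ϑ' : ringClassField K ι (m / ℓ)}
    (hϑ'2 : ϑ' ^ 2 = algebraMap ℚ (ringClassField K ι (m / ℓ)) (d₁ : ℚ)) (hϑ'0 : ϑ' ≠ 0)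
    (hϑϑ' : (ϑ : ℂ) = (legendreSym ℓ d₁ : ℂ) * (ϑ' : ℂ))
    {y : (E'.baseChange (ringClassField K ι m)).toAffine.Point}
    (hy : Affine.Point.map (ringClassField K ι m).subtype.toRatAlgHom y =
      heegnerPointComplexOfConductor Dt (NumberField.discr K) β m)
    {y' : (E'.baseChange (ringClassField K ι (m / ℓ))).toAffine.Point}
    (hy' : Affine.Point.map (ringClassField K ι (m / ℓ)).subtype.toRatAlgHom y' =
      heegnerPointComplexOfConductor Dt (NumberField.discr K) β (m / ℓ))
    {φ₀ : absoluteGaloisGroup (ZMod ℓ)} (hφ₀ : ∀ x : AlgebraicClosure (ZMod ℓ), φ₀ • x = x ^ ℓ)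
    (emb : ringClassField K ι m →+* AlgebraicClosure K)
    (j : ((C₂ • (D • E').quadraticTwist (d₁ : ℚ)).baseChange (ringClassField K ι m)).toAffine.Point →+
      geomPoints ((C₂ • (D • E').quadraticTwist (d₁ : ℚ)).baseChange K))
    (hj : j = Affine.Point.map (W' := C₂ • (D • E').quadraticTwist (d₁ : ℚ)) emb.toRatAlgHom)
    (γ : ringClassField K ι m ≃ₐ[ℚ] ringClassField K ι m) :
    letI : Algebra K ℂ := ι.toAlgebra
    geomReduction hΔ ((RatClosure.pointsEquiv (K := K) (C₂ • (D • E').quadraticTwist (d₁ : ℚ))).symm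
        (j (pointGalHom (C₂ • (D • E').quadraticTwist (d₁ : ℚ)) (ringClassField K ι m) γ
          (VariableChange.pointEquivBaseChange ((D • E').quadraticTwist (d₁ : ℚ)) C₂ (ringClassField K ι m)
          ((VariableChange.pointEquiv (((D • E').quadraticTwist (d₁ : ℚ)).baseChange (ringClassField K ι m)) (untwistAt hϑ0)).symm
            ((Affine.Point.congrEquiv (untwistAt_smul_eq (D • E') hϑ2 hϑ0)).symm
              (VariableChange.pointEquivBaseChange E' D (ringClassField K ι m) y))))))) =
      φ₀ • geomReduction hΔ ((RatClosure.pointsEquiv (K := K) (C₂ • (D • E').quadraticTwist (d₁ : ℚ))).symm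
        (j (pointGalHom (C₂ • (D • E').quadraticTwist (d₁ : ℚ)) (ringClassField K ι m) γ
          (Affine.Point.map ((RingClassField.inclusion ι hle).restrictScalars ℚ)
            (VariableChange.pointEquivBaseChange ((D • E').quadraticTwist (d₁ : ℚ)) C₂ (ringClassField K ι (m / ℓ))
          ((VariableChange.pointEquiv (((D • E').quadraticTwist (d₁ : ℚ)).baseChange (ringClassField K ι (m / ℓ))) (untwistAt hϑ'0)).symm
            ((Affine.Point.congrEquiv (untwistAt_smul_eq (D • E') hϑ'2 hϑ'0)).symm
              (VariableChange.pointEquivBaseChange E' D (ringClassField K ι (m / ℓ)) y')))))))) := by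
  letI : Algebra K ℂ := ι.toAlgebra
  have hℓ : ℓ.Prime := Fact.out
  have hm0 : m ≠ 0 := hm.ne_zero
  have hℓdvd : ℓ ∣ m := Nat.dvd_of_mem_primeFactors hℓm
  have hn : ℓ * (m / ℓ) = m := Nat.mul_div_cancel' hℓdvd
  have hm'0 : m / ℓ ≠ 0 := fun h ↦ hm0 (by rw [← hn, h, mul_zero])
  have hℓm' : ¬ ℓ ∣ m / ℓ := by
    intro h
    have hsq : ℓ * ℓ ∣ m := hn ▸ mul_dvd_mul_left ℓ h
    exact hℓ.one_lt.ne' (Nat.isUnit_iff.mp (hm ℓ hsq))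
  have hℓN : ¬ ℓ ∣ E'.conductorNorm ℤ := fun h ↦
    hℓ.one_lt.ne' ((Nat.Coprime.coprime_dvd_left hℓdvd hmN).eq_one_of_dvd h)
  have hℓE : ¬ (ℓ : ℤ) ∣ minimalDiscriminantInt E' :=
    E'.not_dvd_minimalDiscriminantInt_of_hasGoodReductionAtPrime ℓ hgoodE
  have hw : legendreSym ℓ d₁ = 1 ∨ legendreSym ℓ d₁ = -1 :=
    legendreSym.eq_one_or_neg_one ℓ (by rwa [Ne, ZMod.intCast_zmod_eq_zero_iff_dvd])
  -- the root `ϑ″ = ϑ′↑ ∈ K″[m]`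
  set ϑ'' : ringClassField K ι m := RingClassField.inclusion ι hle ϑ' with hϑ''
  have hϑ''2 : ϑ'' ^ 2 = algebraMap ℚ (ringClassField K ι m) (d₁ : ℚ) := by
    rw [hϑ'', ← map_pow, hϑ'2]
    exact ((RingClassField.inclusion ι hle).restrictScalars ℚ).commutes (d₁ : ℚ)
  have hϑ''0 : ϑ'' ≠ 0 := by
    rw [hϑ'']
    exact (map_ne_zero_iff _ (RingClassField.inclusion_injective ι hle)).mpr hϑ'0
  have hsign : ϑ = ((legendreSym ℓ d₁ : ℤ) : ringClassField K ι m) * ϑ'' := by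
    apply Subtype.ext
    rw [Subfield.coe_mul, hϑϑ', hϑ'']
    show _ = _ * ((RingClassField.inclusion ι hle ϑ' : ringClassField K ι m) : ℂ)
    rw [RingClassField.coe_inclusion]
    push_cast
    rfl
  -- the `E′`-side points over `φ(τ_{Q'})`, `φ(τ_Q)` in `E′(K″[m])`
  set y₀ : (E'.baseChange (ringClassField K ι m)).toAffine.Point :=
    Affine.Point.map ((RingClassField.inclusion ι hle).restrictScalars ℚ) y' with hy₀def
  have hQ := (heegnerFormOfConductor_mem_heegnerForms (N := E'.conductorNorm ℤ) hK.discr_neg hβ hm'0).1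
  have hQ' := GrossLMS1991.heegnerFormOfConductor_eq_conductorMul (NumberField.discr K) β hn.symm
  have hyQ' : Affine.Point.map (ringClassField K ι m).subtype.toRatAlgHom y =
      Dt.φ (heegnerTau (heegnerFormOfConductor (NumberField.discr K) β m)) := by
    rw [hy]; rfl
  have hy₀Q : Affine.Point.map (ringClassField K ι m).subtype.toRatAlgHom y₀ =
      Dt.φ (heegnerTau (heegnerFormOfConductor (NumberField.discr K) β (m / ℓ))) := by
    rw [hy₀def, map_toRatAlgHom_map_inclusion (W := E') ι hle (ringClassField K ι m).subtype
      (ringClassField K ι (m / ℓ)).subtype (fun x' => RingClassField.coe_inclusion ι hle x') y', hy']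
    rfl
  -- Nekovář (4.9) for `E′`, then the transport along `Θ`
  have hN : ∀ (Ω : Type) [Field Ω] (e : ringClassField K ι m →+* Ω) (𝒪 : ValuationSubring Ω),
      (ℓ : Ω) ∈ 𝒪.nonunits →
      FrobCongruentModPlace 𝒪 ℓ ((E'.baseChange (ringClassField K ι m)).mapPointHom e y)
        ((E'.baseChange (ringClassField K ι m)).mapPointHom e y₀) :=
    fun Ω _ e 𝒪 hℓ𝒪 => hNek E' (E'.conductorNorm ℤ) K hK ι Dt (m / ℓ) ℓ m hm'0 hn.symm hℓ hℓN hℓm' hinert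
      _ _ hQ hQ' (Or.inl hℓ2) y y₀ hyQ' hy₀Q Ω e 𝒪 hℓ𝒪
  have hT := frobCongruentModPlace_twist' E' D C₂ d₁ hℓ2 hℓd hℓE hΔ hϑ2 hϑ0 hϑ''2 hϑ''0 hsign hN
  -- `Θ_{ϑ″}(y′↑) = (Θ_{ϑ′} y′)↑`
  have hincl : ((RingClassField.inclusion ι hle).restrictScalars ℚ) ϑ' =
      ((1 : ℤ) : ringClassField K ι m) * ϑ'' := by
    rw [Int.cast_one, one_mul]; rfl
  have h3 := map_twist_of_eq_intCast_mul' E' D C₂ (d₁ : ℚ) hϑ'2 hϑ'0 hϑ''2 hϑ''0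
    ((RingClassField.inclusion ι hle).restrictScalars ℚ) (Or.inl rfl) hincl y'
  rw [one_smul] at h3
  rw [h3]
  -- read through the plumbing (`g = 1`)
  have hj' : ∀ {a b : ringClassField K ι m}
      (hab : ((C₂ • (D • E').quadraticTwist (d₁ : ℚ)).baseChange (ringClassField K ι m)).toAffine.Nonsingular a b),
      ∃ h', j (.some a b hab) = .some (emb a) (emb b) h' := by
    intro a b hab
    subst hj
    exact ⟨_, Affine.Point.map_some _ hab⟩
  have key := geomReduction_pointsEquiv_symm_smul_eq_of_frobCongruent hT j emb hj' hΔ hφ₀ 1 γ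
  rwa [one_smul, one_smul] at key

end Summit.BirchSwinnertonDyer.BirchSwinnertonDyer.Theorems.GenusKolyvagin

end
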